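import Mathlib
import Summits.MatrixMultiplication.MatrixMultiplication.Theorems.AbelianSTPPSieveVP
import Summits.MatrixMultiplication.MatrixMultiplication.Theorems.AbelianSTPPCensusVPSharp338

/-!
# The vP shape census for T_E also FAILS at the PRIME order 521 (prime frontier 509 | 521, upper side in the kernel)

At prime orders the full rule set vP (vM + U11-G + U11-P) excludes every T_E-beating list for all primes `p ≤ 509` (kit j249544, engine
verdicts) but NOT at 521: the list `(7,7,7)⁴, (3,1,1)` is vP-admissible at `M = 521` (every clause of `SieveAdmissible`, all three forms of
U11-G AND of U11-P, by `decide`) and beats `5/2` (`4·343^{5/6} + 3^{5/6} = 521.065… > 521`).  Hence no prime-order census statement of this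
instrument reaches 521 (`shapeExclusionVP_false_at_prime_521`), in particular the Grynkiewicz-free prime rung (vM + U11-P) is capped there
too.  Source of the witness: kit j249544 (stage D3), smallest FEASIBLE prime.  Cell mm-stpp, planner gen 7, 2026-08-26.
WHAT THIS IS NOT: no STPP is claimed to exist with these shapes (the census only fails to exclude it); no ω statement.
-/

-- single-conjunct summit: the mandated namespace repeats `MatrixMultiplication`.
set_option linter.dupNamespace false

namespace Summit.MatrixMultiplication.MatrixMultiplication.Theorems

namespace AbelianSTPPCensusVP

open Finset

/-- The witness list at order 521: `(7,7,7)⁴, (3,1,1)`. -/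
def w521 : List (ℕ × ℕ × ℕ) := [(7,7,7), (7,7,7), (7,7,7), (7,7,7), (3,1,1)]

/-- first sizes -/
def pa : Fin 5 → ℕ := ![7, 7, 7, 7, 3]
/-- middle sizes -/
def pb : Fin 5 → ℕ := ![7, 7, 7, 7, 1]
/-- last sizes -/
def pc : Fin 5 → ℕ := ![7, 7, 7, 7, 1]


/-- The witness beats `5/2` at order 521: `Σ V^{5/6} = 521.065… > 521`. -/
theorem w521_beats : Beats (5 / 2) 521 pa pb pc := by
  unfold Beats
  have hA : (129.64 : ℝ) ≤ (343 : ℝ) ^ ((5 : ℝ) / 6) :=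
    le_rpow_five_sixths (by norm_num) (by norm_num) (by norm_num)
  have hB : (2.49 : ℝ) ≤ (3 : ℝ) ^ ((5 : ℝ) / 6) :=
    le_rpow_five_sixths (by norm_num) (by norm_num) (by norm_num)
  have hexp : ((5 : ℝ) / 2 / 3) = (5 : ℝ) / 6 := by norm_num
  simp only [Fin.sum_univ_five, shapeVol, pa, pb, pc, hexp]
  simp only [Matrix.cons_val_zero, Matrix.cons_val_one, Matrix.cons_val]
  norm_num
  linarith

set_option maxRecDepth 20000 in
/-- The witness is vP-admissible at the prime order 521 (U11-P included). -/
theorem w521_admissible : SieveAdmissibleVP 521 pa pb pc := by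
  refine ⟨?_, ?_, fun _ => ?_⟩
  · -- SieveAdmissible: decidable clauses by `decide`; the U14 tightness implications are vacuous (no `u14Sum` equals 521)
    refine ⟨by decide, by decide, by decide, by decide, by decide, ?_, ?_⟩
    · intro l
      refine ⟨by revert l; decide, fun h => absurd h (by revert l; decide), by revert l; decide,
        fun h => absurd h (by revert l; decide), by revert l; decide, fun h => absurd h (by revert l; decide)⟩
    · intro l
      refine ⟨fun h _ => absurd h (by revert l; decide), fun h _ => absurd h (by revert l; decide),
        fun h _ => absurd h (by revert l; decide)⟩
  · -- U11G, three forms: bounded quantifier over `t`, decidable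
    refine ⟨?_, ?_, ?_⟩ <;> (unfold U11GFormB; decide)
  · -- U11P, three forms (521 is prime): bounded quantifier over `t`, decidable
    refine ⟨?_, ?_, ?_⟩ <;> (unfold U11PFormB; decide)

/-- **No prime-order census statement of the instrument reaches 521** (full vP rule set). -/
theorem shapeExclusionVP_false_at_prime_521 :
    ¬ (∀ (N M : ℕ) (a b c : Fin N → ℕ), 2 ≤ N → M ≤ 521 → M.Prime → SieveAdmissibleVP M a b c → ¬ Beats (5 / 2) M a b c) :=
  fun h => h 5 521 pa pb pc (by norm_num) le_rfl (by norm_num) w521_admissible w521_beats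

/-- The Grynkiewicz-free variant (vM + U11-P only) fails at 521 a fortiori. -/
theorem shapeExclusionVMP_false_at_prime_521 :
    ¬ (∀ (N M : ℕ) (a b c : Fin N → ℕ), 2 ≤ N → M ≤ 521 → M.Prime → SieveAdmissible M a b c → U11P M a b c →
        ¬ Beats (5 / 2) M a b c) :=
  fun h => h 5 521 pa pb pc (by norm_num) le_rfl (by norm_num) w521_admissible.1 (w521_admissible.2.2 (by norm_num))
    w521_beats

end AbelianSTPPCensusVP

end Summit.MatrixMultiplication.MatrixMultiplication.Theorems
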